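import Summits.BirchSwinnertonDyer.BirchSwinnertonDyer.Theorems.AlignedTransportAtTwoMainConjectureOfRankZeroBSDAtTwoTwoFixedPointLambdaParity
import HarnessLib

/-!
# Route `AlignedTransportAtTwo`, crux C2 `MainConjectureOfRankZeroBSDAtTwo` (stmt-BirchSwinnertonDyer-22298):
# EISENSTEIN RIGIDITY IN `Λ = ℤ_p⟦T⟧`, ROOT-FREE — a power series whose constant term has valuation ONE is irreducible,
# and the `λ`-invariant of every divisor of `c·(T+2)·H` (`‖H(0)‖₂ = ½`) lies in `{0, 1, λ(H), λ(H)+1}`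

HONEST FRAMING (cell `bsd-f1-sign2`, WIDTH-5 attached prover seat `bsd-line-att-p5` gen 34 on line `birth` of the lead
`bsd-line-att-p2`; `--supports` stmt-BirchSwinnertonDyer-22298, closes nothing; BSD is NOT proved by any of this; the crux C2, its
verdict «blocked-on `Rank1Residual.GreenbergMuConjectureIrreducible`» and every registered stub are untouched). PURE COMMUTATIVE
ALGEBRA over `Λ = ℤ_p⟦T⟧` — THEOREMS ONLY (no `def`, no named fact, no `sorry`). Sequel of this seat's
`…TwoFixedPointLambdaParity` (`μ`, `λ`, `pfree`, `λ(T+2) = 1`, the `λ = 1` dichotomy) and of the tree's `prime_X_add_C_two`.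

THE POINT. On the `a₂ = +1` half of the cubic Chevalley road the integral `2`-adic `L`-function is `L₀ = (T+2)·H` with
`‖H(0)‖₂ = ½` (this seat's `…RoadSimpleZeroAtChi8`, g33): the distinguished polynomial of `H` is EISENSTEIN. Kato's divisibility
17.4 (2) at `2` says that a generator `f_X` of `char_Λ X(W/ℚ_∞)` divides `2ⁿ·L₀` in `Λ`. This file supplies the algebra that turns
«Eisenstein» into RIGIDITY of the divisors, with no Weierstrass preparation, no roots in `ℂ_p`, no unique factorisation:

* §1 ★ `isUnit_or_isUnit_of_norm_constantCoeff_mul`: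
  **if `‖(A·B)(0)‖ = p⁻¹` then `A` or `B` is a unit of `Λ`** (`‖A(0)‖·‖B(0)‖ = p⁻¹` and both factors lie in `{1} ∪ [0, p⁻¹]`);
  `irreducible_of_norm_constantCoeff` — **every `H ∈ ℤ_p⟦T⟧` with `‖H(0)‖ = p⁻¹` is IRREDUCIBLE** (the root-free Eisenstein
  criterion in `Λ`: it covers `p` itself, `T − pu`, and every power series whose Weierstrass polynomial is Eisenstein).
* §2 in `λ`-currency: `lam_eq_zero_or_lam_eq_zero_of_norm_constantCoeff_mul`, `lam_eq_zero_or_eq_of_eq_mul`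
  (`H = A·B ⇒ λ(A) ∈ {0, λ(H)}`), and with a non-zero constant and `2`-powers floating (the shape Kato's theorem delivers):
  ★ `lam_eq_zero_or_eq_of_mul_eq_C_mul` — **`F·A = C(c)·H`, `c ≠ 0`, `μ(H) = 0`, `‖H(0)‖ = p⁻¹ ⇒ λ(F) ∈ {0, λ(H)}`**
  (strip the `p`-powers by the uniqueness of `g = p^a·g₀`, then §1 on the `p`-free parts).
* §3 at `p = 2` with the linear factor of the second fixed point: ★★ `dvd_or_eq_mul_of_mul_eq_C_mul_X_add_C_two_mul` —
  **`F·A = C(c)·(T+2)·H` ⇒ EITHER `(T+2) ∣ A` and `λ(F) ∈ {0, λ(H)}` OR `F = (T+2)·F₁` with `λ(F₁) ∈ {0, λ(H)}`**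
  (`T+2` is prime), hence `lam_mem_of_mul_eq_C_mul_X_add_C_two_mul`: **`λ(F) ∈ {0, 1, λ(H), λ(H)+1}`** — every intermediate
  value is excluded; with `λ(F)` ODD and `λ(H)` EVEN (the road's parities): `X_add_C_two_dvd_and_lam_eq_of_odd`
  **`(T+2) ∣ F` and `λ(F) ∈ {1, λ(H)+1}`**, and the bottom value is pinned: `lam_eq_one_bottom`
  **`λ(F) = 1 ⇒ F = 2^{μ(F)}·(T+2)·unit` and `‖F(0)‖₂ = 2^{−(μ(F)+1)}`**.
The curve-facing consequences (Kato 17.4 (2) at `2` + the road: `λ(X(W/ℚ_∞)) ∈ {1, λ₂}`, the residue of C2 on the `a₂ = +1` road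
is ONE BIT) are in the companion file `…EisensteinRigidityRoad`.

References: L. Washington, GTM 83, §7.1 (Weierstrass preparation, distinguished / Eisenstein polynomials) [Washington1997];
R. Greenberg, LNM 1716 (1999), §5 p. 181 [GreenbergLNM1716]; K. Kato, Astérisque 295 (2004), Thm. 17.4 [Kato2004Asterisque].
-/

set_option linter.dupNamespace false
set_option autoImplicit false

noncomputable section

open scoped Classical

namespace Summit.BirchSwinnertonDyer.BirchSwinnertonDyer.Theorems.AlignedTransportAtTwoEisensteinRigidity

open PowerSeries Literature.NumberTheory.EllipticCurves
  Summit.BirchSwinnertonDyer.Rank1Residual.X1.MuLambda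
  Summit.BirchSwinnertonDyer.BirchSwinnertonDyer.Theorems.AlignedTransportAtTwoTwoFixedPoints

/-! ## §1 `‖H(0)‖ = p⁻¹` ⇒ `H` is irreducible in `Λ = ℤ_p⟦T⟧` (root-free Eisenstein) -/

section AnyPrime

variable {p : ℕ} [Fact p.Prime]

/-- **ROOT-FREE EISENSTEIN CRITERION IN `Λ`.** If the constant term of `A·B ∈ ℤ_p⟦T⟧` has norm exactly `p⁻¹` (valuation one),
then `A` or `B` is a unit of `Λ`: `‖A(0)‖·‖B(0)‖ = p⁻¹` while two non-units would give `≤ p⁻²`. [cite: Washington1997, §7.1] -/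
theorem isUnit_or_isUnit_of_norm_constantCoeff_mul {A B : PowerSeries ℤ_[p]}
    (h : ‖constantCoeff (A * B)‖ = (p : ℝ)⁻¹) : IsUnit A ∨ IsUnit B := by
  -- a non-unit of `ℤ_p` is divisible by `p`, so has norm `≤ p⁻¹` (tree: `EtaPlusCoeffCongruence.norm_le_inv_of_not_isUnit`)
  have norm_le_inv_of_not_isUnit : ∀ {x : ℤ_[p]}, ¬ IsUnit x → ‖x‖ ≤ (p : ℝ)⁻¹ := by
    intro x hx
    have hlt : ‖x‖ < 1 := lt_of_le_of_ne (PadicInt.norm_le_one x) (fun h => hx (PadicInt.isUnit_iff.mpr h))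
    obtain ⟨y, rfl⟩ := (PadicInt.norm_lt_one_iff_dvd x).mp hlt
    rw [norm_mul, PadicInt.norm_p]
    calc (p : ℝ)⁻¹ * ‖y‖ ≤ (p : ℝ)⁻¹ * 1 := by gcongr; exact PadicInt.norm_le_one y
      _ = (p : ℝ)⁻¹ := mul_one _
  by_contra hAB
  obtain ⟨hA, hB⟩ := not_or.mp hAB
  have hA' : ¬ IsUnit (constantCoeff A) := fun hu => hA (PowerSeries.isUnit_iff_constantCoeff.mpr hu)
  have hB' : ¬ IsUnit (constantCoeff B) := fun hu => hB (PowerSeries.isUnit_iff_constantCoeff.mpr hu)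
  have hp1 : (1 : ℝ) < p := by exact_mod_cast (Fact.out : p.Prime).one_lt
  have hpinv : (0 : ℝ) < (p : ℝ)⁻¹ := by positivity
  have hle : ‖constantCoeff (A * B)‖ ≤ (p : ℝ)⁻¹ * (p : ℝ)⁻¹ := by
    rw [map_mul, norm_mul]
    exact mul_le_mul (norm_le_inv_of_not_isUnit hA') (norm_le_inv_of_not_isUnit hB') (norm_nonneg _) hpinv.le
  rw [h] at hle
  have h1 : (1 : ℝ) ≤ (p : ℝ)⁻¹ := by
    have := div_le_div_of_nonneg_right hle hpinv.le
    rwa [div_self hpinv.ne', mul_div_assoc, div_self hpinv.ne', mul_one] at this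
  have h2 : (p : ℝ)⁻¹ < 1 := inv_lt_one_of_one_lt₀ hp1
  linarith

/-- The same with a named product: `‖H(0)‖ = p⁻¹`, `H = A·B ⇒ A ∈ Λˣ ∨ B ∈ Λˣ`. [cite: Washington1997, §7.1] -/
theorem isUnit_or_isUnit_of_eq_mul {H A B : PowerSeries ℤ_[p]} (hH : ‖constantCoeff H‖ = (p : ℝ)⁻¹) (h : H = A * B) :
    IsUnit A ∨ IsUnit B :=
  isUnit_or_isUnit_of_norm_constantCoeff_mul (h ▸ hH)

/-- **Every `H ∈ ℤ_p⟦T⟧` whose constant term has valuation one is IRREDUCIBLE in `Λ`** (it is not a unit since `‖H(0)‖ < 1`).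
This covers `p`, `T − p·u`, and every power series whose Weierstrass polynomial is an Eisenstein polynomial — with no Weierstrass
preparation and no roots. [cite: Washington1997, §7.1] -/
theorem irreducible_of_norm_constantCoeff {H : PowerSeries ℤ_[p]} (hH : ‖constantCoeff H‖ = (p : ℝ)⁻¹) : Irreducible H := by
  have hp1 : (1 : ℝ) < p := by exact_mod_cast (Fact.out : p.Prime).one_lt
  refine irreducible_iff.mpr ⟨fun hu => ?_, fun a b h => isUnit_or_isUnit_of_eq_mul hH h⟩
  have h1 : ‖constantCoeff H‖ = 1 := PadicInt.isUnit_iff.mp (PowerSeries.isUnit_iff_constantCoeff.mp hu)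
  rw [hH] at h1
  exact (inv_lt_one_of_one_lt₀ hp1).ne h1

/-- A power series with `‖H(0)‖ = p⁻¹` is non-zero. [folklore] -/
theorem ne_zero_of_norm_constantCoeff {H : PowerSeries ℤ_[p]} (hH : ‖constantCoeff H‖ = (p : ℝ)⁻¹) : H ≠ 0 := by
  rintro rfl
  rw [map_zero, norm_zero] at hH
  have hp1 : (1 : ℝ) < p := by exact_mod_cast (Fact.out : p.Prime).one_lt
  have : (0 : ℝ) < (p : ℝ)⁻¹ := by positivity
  exact this.ne hH

/-! ## §2 The same in `λ`-currency, with constants and `p`-powers floating -/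

/-- A unit of `Λ` has `λ = 0`. [folklore] -/
theorem lam_eq_zero_of_isUnit {u : PowerSeries ℤ_[p]} (hu : IsUnit u) : lam u = 0 :=
  ((isUnit_iff_mu_eq_zero_and_lam_eq_zero u).mp hu).2.2

/-- A unit of `Λ` has `μ = 0`. [folklore] -/
theorem mu_eq_zero_of_isUnit {u : PowerSeries ℤ_[p]} (hu : IsUnit u) : mu u = 0 :=
  ((isUnit_iff_mu_eq_zero_and_lam_eq_zero u).mp hu).2.1

/-- `‖(A·B)(0)‖ = p⁻¹ ⇒ λ(A) = 0 ∨ λ(B) = 0`. [cite: Washington1997, §7.1] -/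
theorem lam_eq_zero_or_lam_eq_zero_of_norm_constantCoeff_mul {A B : PowerSeries ℤ_[p]}
    (h : ‖constantCoeff (A * B)‖ = (p : ℝ)⁻¹) : lam A = 0 ∨ lam B = 0 :=
  (isUnit_or_isUnit_of_norm_constantCoeff_mul h).imp lam_eq_zero_of_isUnit lam_eq_zero_of_isUnit

/-- **`H = A·B` with `‖H(0)‖ = p⁻¹ ⇒ λ(A) ∈ {0, λ(H)}`** (`λ` is additive and one factor is a unit). [cite: Washington1997, §7.1] -/
theorem lam_eq_zero_or_eq_of_eq_mul {H A B : PowerSeries ℤ_[p]} (hH : ‖constantCoeff H‖ = (p : ℝ)⁻¹) (h : H = A * B) :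
    lam A = 0 ∨ lam A = lam H := by
  have hH0 : H ≠ 0 := ne_zero_of_norm_constantCoeff hH
  have hA0 : A ≠ 0 := by rintro rfl; exact hH0 (by rw [h, zero_mul])
  have hB0 : B ≠ 0 := by rintro rfl; exact hH0 (by rw [h, mul_zero])
  rcases isUnit_or_isUnit_of_eq_mul hH h with hA | hB
  · exact Or.inl (lam_eq_zero_of_isUnit hA)
  · right
    rw [h, lam_mul hA0 hB0, lam_eq_zero_of_isUnit hB, add_zero]

/-- `λ(pfree g) = λ(g)` and `μ(pfree g) = 0` for `g ≠ 0` (any `p`). [folklore] -/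
theorem mu_pfree_and_lam_pfree_anyPrime {g : PowerSeries ℤ_[p]} (hg : g ≠ 0) : mu (pfree g) = 0 ∧ lam (pfree g) = lam g := by
  obtain ⟨hmu, hpf⟩ := mu_eq_and_pfree_eq (p := p) (g := pfree g) (g₀ := pfree g) (a := 0) (red_pfree_ne_zero hg) (by simp)
  exact ⟨hmu, by rw [lam, lam, hpf]⟩

/-- `μ(H) = 0 ⇒ pfree H = H` (and then `red H ≠ 0` for `H ≠ 0`). [folklore] -/
theorem pfree_eq_self_of_mu_eq_zero {H : PowerSeries ℤ_[p]} (hμ : mu H = 0) : pfree H = H := by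
  have h := eq_C_pow_mu_mul_pfree (p := p) H
  rw [hμ, pow_zero, map_one, one_mul] at h
  exact h.symm

/-- **KATO'S SHAPE: `F·A = C(c)·H`, `c ≠ 0`, `μ(H) = 0`, `‖H(0)‖ = p⁻¹ ⇒ λ(F) ∈ {0, λ(H)}`.** Strip the `p`-powers: with
`c = u·p^e`, `F = p^a·F₀`, `A = p^b·A₀` (`p`-free parts) the uniqueness of such decompositions gives `F₀·A₀ = u·H`, whose constant
term again has norm `p⁻¹`; §1 makes `F₀` or `A₀` a unit, and `λ(F) = λ(F₀)`, `λ(F₀) + λ(A₀) = λ(H)`.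
[cite: Washington1997, §7.1] [cite: Kato2004Asterisque, Thm. 17.4 (2) (p. 273)] -/
theorem lam_eq_zero_or_eq_of_mul_eq_C_mul {F A H : PowerSeries ℤ_[p]} {c : ℤ_[p]} (hc : c ≠ 0)
    (hH : ‖constantCoeff H‖ = (p : ℝ)⁻¹) (hμ : mu H = 0) (h : F * A = C c * H) : lam F = 0 ∨ lam F = lam H := by
  have hH0 : H ≠ 0 := ne_zero_of_norm_constantCoeff hH
  have hCc : (C c : PowerSeries ℤ_[p]) ≠ 0 := fun h0 => hc (C_injective (h0.trans (map_zero _).symm))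
  have hFA : F * A ≠ 0 := by rw [h]; exact mul_ne_zero hCc hH0
  have hF0 : F ≠ 0 := left_ne_zero_of_mul hFA
  have hA0 : A ≠ 0 := right_ne_zero_of_mul hFA
  -- `c = u · p^e`
  set u : ℤ_[p]ˣ := PadicInt.unitCoeff hc with hu_def
  have hcu : c = (u : ℤ_[p]) * (p : ℤ_[p]) ^ c.valuation := PadicInt.unitCoeff_spec hc
  -- `p`-free parts
  have hF := eq_C_pow_mu_mul_pfree (p := p) F
  have hA := eq_C_pow_mu_mul_pfree (p := p) A
  have hredF : red (pfree F) ≠ 0 := red_pfree_ne_zero hF0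
  have hredA : red (pfree A) ≠ 0 := red_pfree_ne_zero hA0
  have hredH : red H ≠ 0 := by rw [← pfree_eq_self_of_mu_eq_zero hμ]; exact red_pfree_ne_zero hH0
  -- the equation `p^(a+b) · (F₀ A₀) = p^e · (u H)`
  have hkey : C ((p : ℤ_[p]) ^ (mu F + mu A)) * (pfree F * pfree A) =
      C ((p : ℤ_[p]) ^ c.valuation) * (C (u : ℤ_[p]) * H) := by
    calc C ((p : ℤ_[p]) ^ (mu F + mu A)) * (pfree F * pfree A)
        = (C ((p : ℤ_[p]) ^ mu F) * pfree F) * (C ((p : ℤ_[p]) ^ mu A) * pfree A) := by rw [pow_add, map_mul]; ring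
      _ = F * A := by rw [← hF, ← hA]
      _ = C c * H := h
      _ = C ((p : ℤ_[p]) ^ c.valuation) * (C (u : ℤ_[p]) * H) := by
          conv_lhs => rw [hcu]
          rw [map_mul]; ring
  have hred1 : red (pfree F * pfree A) ≠ 0 := by
    rw [red, map_mul]; exact mul_ne_zero hredF hredA
  have hures : IsLocalRing.residue ℤ_[p] (u : ℤ_[p]) ≠ 0 := (u.isUnit.map _).ne_zero
  have hred2 : red (C (u : ℤ_[p]) * H) ≠ 0 := by
    rw [red, map_mul, PowerSeries.map_C]
    exact mul_ne_zero (fun h0 => hures (C_injective (h0.trans (map_zero _).symm))) hredH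
  obtain ⟨-, hprod⟩ := eq_of_C_pow_mul_eq hred1 hred2 hkey
  -- norms of constant terms: `‖(F₀A₀)(0)‖ = ‖u‖ · ‖H(0)‖ = p⁻¹`
  have hnorm : ‖constantCoeff (pfree F * pfree A)‖ = (p : ℝ)⁻¹ := by
    rw [hprod, map_mul, constantCoeff_C, norm_mul, PadicInt.isUnit_iff.mp u.isUnit, one_mul, hH]
  have hpfF0 : pfree F ≠ 0 := pfree_ne_zero hF0
  have hpfA0 : pfree A ≠ 0 := pfree_ne_zero hA0
  have hlamF : lam (pfree F) = lam F := (mu_pfree_and_lam_pfree_anyPrime hF0).2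
  rcases lam_eq_zero_or_lam_eq_zero_of_norm_constantCoeff_mul hnorm with h0 | h0
  · exact Or.inl (hlamF ▸ h0)
  · right
    have hCu : IsUnit (C (u : ℤ_[p]) : PowerSeries ℤ_[p]) := u.isUnit.map _
    have hsum : lam (pfree F * pfree A) = lam (C (u : ℤ_[p]) * H) := by rw [hprod]
    rw [lam_mul hpfF0 hpfA0, lam_mul hCu.ne_zero hH0, lam_eq_zero_of_isUnit hCu, zero_add, h0, add_zero, hlamF] at hsum
    exact hsum

end AnyPrime

/-! ## §3 `p = 2`: divisors of `c·(T+2)·H` — `λ ∈ {0, 1, λ(H), λ(H)+1}`, and the odd case -/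

section Two

/-- `((2 : ℕ) : ℝ)⁻¹ = 2⁻¹` (cast bookkeeping between the any-prime statements and `p = 2`). [folklore] -/
theorem natCast_two_inv : ((2 : ℕ) : ℝ)⁻¹ = (2 : ℝ)⁻¹ := by norm_num

/-- **DIVISORS OF `c·(T+2)·H`.** In `ℤ₂⟦T⟧` let `F·A = C(c)·((T+2)·H)` with `c ≠ 0`, `μ(H) = 0`, `‖H(0)‖₂ = ½`. Since `T+2` is prime,
EITHER `(T+2) ∣ A` and `λ(F) ∈ {0, λ(H)}`, OR `F = (T+2)·F₁` with `λ(F₁) ∈ {0, λ(H)}`. [cite: Washington1997, §7.1]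
[cite: GreenbergLNM1716, §5 p. 181] -/
theorem dvd_or_eq_mul_of_mul_eq_C_mul_X_add_C_two_mul {F A H : PowerSeries ℤ_[2]} {c : ℤ_[2]} (hc : c ≠ 0)
    (hH : ‖constantCoeff H‖ = (2 : ℝ)⁻¹) (hμ : mu H = 0) (h : F * A = C c * ((X + C (2 : ℤ_[2])) * H)) :
    ((X + C (2 : ℤ_[2])) ∣ A ∧ (lam F = 0 ∨ lam F = lam H)) ∨
      (∃ F₁ : PowerSeries ℤ_[2], F = (X + C (2 : ℤ_[2])) * F₁ ∧ (lam F₁ = 0 ∨ lam F₁ = lam H)) := by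
  have hX : Prime (X + C (2 : ℤ_[2]) : PowerSeries ℤ_[2]) := prime_X_add_C_two
  have hH' : ‖constantCoeff H‖ = ((2 : ℕ) : ℝ)⁻¹ := by rw [natCast_two_inv]; exact hH
  have hdvd : (X + C (2 : ℤ_[2])) ∣ F * A := ⟨C c * H, by rw [h]; ring⟩
  rcases hX.dvd_or_dvd hdvd with hF | hA
  · right
    obtain ⟨F₁, rfl⟩ := hF
    refine ⟨F₁, rfl, ?_⟩
    have h' : F₁ * A = C c * H := by
      apply mul_left_cancel₀ hX.ne_zero
      calc (X + C (2 : ℤ_[2])) * (F₁ * A) = (X + C (2 : ℤ_[2])) * F₁ * A := by ring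
        _ = C c * ((X + C (2 : ℤ_[2])) * H) := h
        _ = (X + C (2 : ℤ_[2])) * (C c * H) := by ring
    exact lam_eq_zero_or_eq_of_mul_eq_C_mul hc hH' hμ h'
  · left
    obtain ⟨A₁, rfl⟩ := hA
    refine ⟨dvd_mul_right _ _, ?_⟩
    have h' : F * A₁ = C c * H := by
      apply mul_left_cancel₀ hX.ne_zero
      calc (X + C (2 : ℤ_[2])) * (F * A₁) = F * ((X + C (2 : ℤ_[2])) * A₁) := by ring
        _ = C c * ((X + C (2 : ℤ_[2])) * H) := h
        _ = (X + C (2 : ℤ_[2])) * (C c * H) := by ring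
    exact lam_eq_zero_or_eq_of_mul_eq_C_mul hc hH' hμ h'

/-- **`λ(F) ∈ {0, 1, λ(H), λ(H)+1}` for every divisor `F` of `c·(T+2)·H`** (`c ≠ 0`, `μ(H) = 0`, `‖H(0)‖₂ = ½`): all intermediate
values of the `λ`-inequality `λ(F) ≤ 1 + λ(H)` are EXCLUDED. [cite: Washington1997, §7.1] [cite: Kato2004Asterisque, Thm. 17.4 (2) (p. 273)] -/
theorem lam_mem_of_mul_eq_C_mul_X_add_C_two_mul {F A H : PowerSeries ℤ_[2]} {c : ℤ_[2]} (hc : c ≠ 0)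
    (hH : ‖constantCoeff H‖ = (2 : ℝ)⁻¹) (hμ : mu H = 0) (h : F * A = C c * ((X + C (2 : ℤ_[2])) * H)) :
    lam F = 0 ∨ lam F = 1 ∨ lam F = lam H ∨ lam F = lam H + 1 := by
  have hX : Prime (X + C (2 : ℤ_[2]) : PowerSeries ℤ_[2]) := prime_X_add_C_two
  have hH0 : H ≠ 0 := ne_zero_of_norm_constantCoeff (p := 2) (by rw [natCast_two_inv]; exact hH)
  have hCc : (C c : PowerSeries ℤ_[2]) ≠ 0 := fun h0 => hc (C_injective (h0.trans (map_zero _).symm))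
  have hFA : F * A ≠ 0 := by rw [h]; exact mul_ne_zero hCc (mul_ne_zero hX.ne_zero hH0)
  have hF0 : F ≠ 0 := left_ne_zero_of_mul hFA
  rcases dvd_or_eq_mul_of_mul_eq_C_mul_X_add_C_two_mul hc hH hμ h with ⟨-, h0 | h1⟩ | ⟨F₁, hF, h01⟩
  · exact Or.inl h0
  · exact Or.inr (Or.inr (Or.inl h1))
  · have hF₁0 : F₁ ≠ 0 := by rintro rfl; exact hF0 (by rw [hF, mul_zero])
    have hlam : lam F = 1 + lam F₁ := by rw [hF, lam_mul hX.ne_zero hF₁0, lam_X_add_C_two]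
    rcases h01 with h0 | h1
    · exact Or.inr (Or.inl (by rw [hlam, h0]))
    · exact Or.inr (Or.inr (Or.inr (by rw [hlam, h1, add_comm])))

/-- **THE ODD CASE: `λ(F)` odd, `λ(H)` even ⇒ `(T+2) ∣ F` and `λ(F) ∈ {1, λ(H)+1}`** — exactly the parities of the cubic Chevalley
road (`λ_alg` odd by Matsuno's Prop. 6.4 + the functional equation, `λ(H) = λ₂ − 1` even). [cite: Washington1997, §7.1]
[cite: GreenbergLNM1716, §5 p. 181] -/
theorem X_add_C_two_dvd_and_lam_eq_of_odd {F A H : PowerSeries ℤ_[2]} {c : ℤ_[2]} (hc : c ≠ 0)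
    (hH : ‖constantCoeff H‖ = (2 : ℝ)⁻¹) (hμ : mu H = 0) (h : F * A = C c * ((X + C (2 : ℤ_[2])) * H))
    (hodd : Odd (lam F)) (heven : Even (lam H)) :
    (∃ F₁ : PowerSeries ℤ_[2], F = (X + C (2 : ℤ_[2])) * F₁ ∧ (lam F₁ = 0 ∨ lam F₁ = lam H)) ∧
      (lam F = 1 ∨ lam F = lam H + 1) := by
  have hX : Prime (X + C (2 : ℤ_[2]) : PowerSeries ℤ_[2]) := prime_X_add_C_two
  have hH0 : H ≠ 0 := ne_zero_of_norm_constantCoeff (p := 2) (by rw [natCast_two_inv]; exact hH)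
  have hCc : (C c : PowerSeries ℤ_[2]) ≠ 0 := fun h0 => hc (C_injective (h0.trans (map_zero _).symm))
  have hFA : F * A ≠ 0 := by rw [h]; exact mul_ne_zero hCc (mul_ne_zero hX.ne_zero hH0)
  have hF0 : F ≠ 0 := left_ne_zero_of_mul hFA
  rcases dvd_or_eq_mul_of_mul_eq_C_mul_X_add_C_two_mul hc hH hμ h with ⟨-, h0 | h1⟩ | ⟨F₁, hF, h01⟩
  · exfalso; rw [h0] at hodd; exact (Nat.not_odd_iff_even.mpr Even.zero) hodd
  · exfalso; rw [h1] at hodd; exact (Nat.not_odd_iff_even.mpr heven) hodd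
  · have hF₁0 : F₁ ≠ 0 := by rintro rfl; exact hF0 (by rw [hF, mul_zero])
    have hlam : lam F = 1 + lam F₁ := by rw [hF, lam_mul hX.ne_zero hF₁0, lam_X_add_C_two]
    refine ⟨⟨F₁, hF, h01⟩, ?_⟩
    rcases h01 with h0 | h1
    · exact Or.inl (by rw [hlam, h0])
    · exact Or.inr (by rw [hlam, h1, add_comm])

/-- **THE BOTTOM VALUE PINNED.** If `(T+2) ∣ F ≠ 0` and `λ(F) = 1` then `F = 2^{μ(F)}·(T+2)·u` with `u ∈ Λˣ`, so
`‖F(0)‖₂ = 2^{−(μ(F)+1)}`: the characteristic power series is `2^{μ}·(T+2)` up to a unit. [cite: Washington1997, §7.1] -/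
theorem eq_C_pow_mul_X_add_C_two_mul_unit_of_lam_eq_one {F : PowerSeries ℤ_[2]} (hF0 : F ≠ 0)
    (hdvd : (X + C (2 : ℤ_[2])) ∣ F) (h1 : lam F = 1) :
    ∃ u : PowerSeries ℤ_[2], IsUnit u ∧ F = C ((2 : ℤ_[2]) ^ mu F) * ((X + C (2 : ℤ_[2])) * u) ∧
      ‖constantCoeff F‖ = (2 : ℝ)⁻¹ ^ (mu F + 1) := by
  obtain ⟨u, hu, hpf⟩ := (lam_eq_one_iff_of_X_add_C_two_dvd hF0 hdvd).mp h1
  have hF : F = C ((2 : ℤ_[2]) ^ mu F) * ((X + C (2 : ℤ_[2])) * u) := by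
    have h := eq_C_pow_mu_mul_pfree (p := 2) F
    rw [hpf] at h
    exact_mod_cast h
  refine ⟨u, hu, hF, ?_⟩
  have hu0 : ‖constantCoeff u‖ = 1 := PadicInt.isUnit_iff.mp (PowerSeries.isUnit_iff_constantCoeff.mp hu)
  have h2 : ‖(2 : ℤ_[2])‖ = 2⁻¹ := by
    rw [show (2 : ℤ_[2]) = ((2 : ℕ) : ℤ_[2]) by norm_cast, PadicInt.norm_p]; norm_num
  have hc : constantCoeff F = (2 : ℤ_[2]) ^ mu F * (2 * constantCoeff u) := by
    conv_lhs => rw [hF]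
    rw [map_mul, map_mul, map_add, constantCoeff_C, constantCoeff_X, constantCoeff_C, zero_add]
  rw [hc, norm_mul, norm_mul, norm_pow, h2, hu0, mul_one, pow_succ]

end Two

end Summit.BirchSwinnertonDyer.BirchSwinnertonDyer.Theorems.AlignedTransportAtTwoEisensteinRigidity

end
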